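import Literature.NumberTheory.Kottwitz1992.SemisimpleCategories
import Literature.NumberTheory.Automorphic.QuaternionAlgebraClassification
import Mathlib.RingTheory.SimpleModule.WedderburnArtin
import Mathlib.RingTheory.Artinian.Module
import Mathlib.Algebra.Module.Torsion.Basic
import HarnessLib

/-!
# [Kottwitz1992, Lemma 3.3 (p. 384), first sentence] simple `B ⊗_L D^opp`-modules ↔ factors of `F ⊗_L M` — DISCHARGED:
# `Kottwitz1992_3_3_simple_objects_bijection_holds`

Kernel-lane companion of the statement carpet ★ `Literature/NumberTheory/Kottwitz1992/SemisimpleCategories.lean` (squad TK,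
HCML «GO 500»): the named fact ★ `SemisimpleCategories.Kottwitz1992_3_3_simple_objects_bijection` — Lemma 3.3, first
sentence, in the carpet's REDUCED MODEL of the printed proof («it is enough to consider the case in which `𝒞` is the category
of finitely generated left modules over the division algebra `D^opp`.  Then `𝒞_B` is equivalent to the category of finitely
generated left `D' := B ⊗_L D^opp`-modules», p. 384): for `B` simple with centre the field `F`, `D` a division algebra with
centre `M` (all finite-dimensional over `L`), simple `D'`-modules up to isomorphism correspond to the maximal ideals of
`F ⊗_L M` through the annihilator — (a) every simple `D'`-module is annihilated by exactly one maximal ideal, (b) two simple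
modules annihilated by the same maximal ideal are isomorphic, (c) every maximal ideal occurs — is PROVED here.  THEOREMS ONLY
(no definition, no named fact, no `sorry`, no instance, no notation); cell hodgecm-mathlib, seat B-typ04 (g33); net debt −1.

R. E. Kottwitz, *Points on some Shimura varieties over finite fields*, J. Amer. Math. Soc. 5 (1992) 373–444, Lemma 3.3
p. 384 (held `paper:doi-10-2307-2152772`, p0012).  THE PRINTED PROOF: «The center of `D'` is `F ⊗_L M = M₁ × ⋯ × M_r`, and
`D'` factors in a parallel way as `D₁ × ⋯ × D_r` where `D_j` is a simple algebra with center `M_j`.  The first statement of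
the lemma is now clear.  Fix one of the factors `M_j`, call it `E`; the corresponding factor `D_j` of `D'` is isomorphic to
`(B ⊗_F E) ⊗_E (D^opp ⊗_M E)` …».

THE PROOF FOLLOWED, and where we deviate.  We work with ONE factor at a time, in the printed model
`S_E := (E ⊗_F B) ⊗_E (E ⊗_M D^opp)` of `D_j` (`E = (F ⊗_L M)/𝔪` the residue field of the maximal ideal `𝔪`), and never
need the Wedderburn decomposition `D' = D₁ × ⋯ × D_r` itself:
* **(a)** the annihilator of a simple `D'`-module `X` in `F ⊗_L M` is PRIME by Schur's lemma (an element `z` of `F ⊗_L M`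
  acts on `X` through the CENTRAL element `centerMap z` of `D'`, hence by a `D'`-linear endomorphism of the simple `X`, which is
  bijective or zero — Mathlib `LinearMap.bijective_or_eq_zero`), and `F ⊗_L M` is artinian (finite-dimensional over `L`: `F` and
  `M` embed `L`-linearly in the finite-dimensional `B`, `D`), so the annihilator is MAXIMAL (`IsArtinianRing.isMaximal_of_isPrime`);
  a maximal ideal annihilating `X` is contained in, hence equal to, the annihilator (`Lemma33.existsUnique_annihilator`);
* **the factor** `S_E` is SIMPLE for every field `E` over `F` and `M` — `E ⊗_F B` is central simple over `E` (`Z(B) = F` makes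
  `B` central simple over `F`; the tree's ★ `IsSimpleRing.tensorProduct_of_isCentral'` and ★ `BaseChange.isCentral_baseChange`),
  `E ⊗_M D^opp` is simple (`Z(D^opp) = M`), and «central simple ⊗ simple is simple» (★ `IsSimpleRing.tensorProduct_of_isCentral`)
  (`Lemma33.isSimpleRing_factor`) — and artinian (finite-dimensional over `E`, `Lemma33.isArtinianRing_factor`);
* **(c)** the projection `Φ : D' → S_E`, `b ⊗ d ↦ (1 ⊗ b) ⊗ (1 ⊗ d)` (`Lemma33.exists_ringHom_factor`, by the universal property
  of `B ⊗_L D^opp`) sends `centerMap z` to the scalar `z mod 𝔪`, so it kills the left ideal `D'·centerMap(𝔪)`; as `S_E ≠ 0`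
  this ideal is proper, a maximal left ideal `N` above it exists (Krull), and `D'/N` is a simple `D'`-module annihilated by
  `𝔪` (`Lemma33.exists_simple_annihilated`);
* **(b)** a simple `D'`-module `X` annihilated by `𝔪` is an `E`-vector space (Mathlib `Module.IsTorsionBySet.module`) on which
  `F ⊆ B` and `M ⊆ D^opp` act through `E`; the universal property of the tensor product of algebras
  (`Algebra.TensorProduct.lift` applied to `B →ₐ[F] End_E X`, `D^opp →ₐ[M] End_E X`) makes it an `S_E`-module with
  `((e ⊗ b) ⊗ (e' ⊗ d))·x = (e e')·(b ⊗ d)·x` (`Lemma33.exists_ringHom_end`), still simple (`Lemma33.isSimpleModule_factor`); two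
  such modules are isomorphic over `S_E`, because a simple artinian ring has a unique simple module (Mathlib
  `IsSimpleRing.isIsotypic`, applied to `X × X'` — `Lemma33.nonempty_linearEquiv_of_isSimpleRing`), and an `S_E`-linear
  isomorphism is `D'`-linear (`Lemma33.nonempty_linearEquiv_of_factor`, `Lemma33.nonempty_linearEquiv_of_annihilated`).
The printed hypothesis «`L` of characteristic 0» is carried by the named fact but NOT used: the argument above needs only
`Z(B) = F`, `Z(D) = M` and finite-dimensionality (in characteristic `0` the ring `F ⊗_L M` is moreover reduced, i.e. a product
of fields, which is what makes the printed `D'` semisimple; the bijection with the MAXIMAL ideals holds regardless).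
HONEST LABEL: HC_CM is proved only modulo the 7 printed citations (2 remaining named inputs: hLiu418, h413) until rung 0 closes;
this file is off that cone, adds no citation debt (0 facts, 0 `sorry`) and discharges 1 named fact of ★ `SemisimpleCategories`.

Lean note (for re-users of `S_E`): instance search does not see through the nested tensor product well — `algebraMap E S_E`
gets stuck, `NeZero (1 : S_E)`/`zero_smul` rewrites fail on literal `0`/`1`; the file therefore names the factor only through
terms elaborated in ONE generic context (`section Factor`/`Phi`/`Rho`, `E` a field variable) and specialises `E := (F ⊗_L M)/𝔪`
(`Ideal.Quotient.field`, `Algebra.TensorProduct.rightAlgebra` as local instances) only in `section Assembly`.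
-/

noncomputable section

open scoped TensorProduct

namespace Literature.NumberTheory.Kottwitz1992.SemisimpleCategories

universe u

namespace Lemma33

variable {L : Type u} [Field L] {F : Type u} [Field F] [Algebra L F]
  {B : Type u} [Ring B] [Algebra L B] [Algebra F B] [IsScalarTower L F B]
  {M : Type u} [Field M] [Algebra L M] {D : Type u} [DivisionRing D] [Algebra L D] [Algebra M D]
  [IsScalarTower L M D]

/-! ### §0 The setting: `F = Z(B)`, `M = Z(D)`, finiteness -/

/-- `F` is finite-dimensional over `L`: it embeds `L`-linearly into the finite-dimensional `B`. [cite: Kottwitz1992, Lemma 3.3 (proof, p. 384)] -/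
theorem finite_F [FiniteDimensional L B] [Nontrivial B] : Module.Finite L F :=
  Module.Finite.of_injective (IsScalarTower.toAlgHom L F B).toLinearMap (algebraMap F B).injective

/-- `M` is finite-dimensional over `L`: it embeds `L`-linearly into the finite-dimensional `D`. [cite: Kottwitz1992, Lemma 3.3 (proof, p. 384)] -/
theorem finite_M [FiniteDimensional L D] : Module.Finite L M :=
  Module.Finite.of_injective (IsScalarTower.toAlgHom L M D).toLinearMap (algebraMap M D).injective

/-- `B` is finite-dimensional over its centre `F`. [cite: Kottwitz1992, Lemma 3.3 (proof, p. 384)] -/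
theorem finite_FB [FiniteDimensional L B] : Module.Finite F B :=
  Module.Finite.of_restrictScalars_finite L F B

/-- `D^opp` is finite-dimensional over `M`. [cite: Kottwitz1992, Lemma 3.3 (proof, p. 384)] -/
theorem finite_MDop [FiniteDimensional L D] : Module.Finite M Dᵐᵒᵖ :=
  haveI : Module.Finite M D := Module.Finite.of_restrictScalars_finite L M D
  Module.Finite.equiv (MulOpposite.opLinearEquiv M : D ≃ₗ[M] Dᵐᵒᵖ)

omit [Algebra L F] [IsScalarTower L F B] in
/-- `Z(B) = F` makes `B` a central `F`-algebra. [cite: Kottwitz1992, Lemma 3.3 (proof, p. 384)] -/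
theorem isCentral_FB (hF : Set.range (algebraMap F B) = (Subalgebra.center L B : Set B)) :
    Algebra.IsCentral F B := by
  refine ⟨fun x hx ↦ ?_⟩
  have hx' : x ∈ (Subalgebra.center L B : Set B) := by
    rw [SetLike.mem_coe, Subalgebra.mem_center_iff]
    exact Subalgebra.mem_center_iff.mp hx
  rw [← hF] at hx'
  exact Algebra.mem_bot.mpr hx'

omit [Algebra L M] [IsScalarTower L M D] in
/-- `Z(D) = M` makes `D^opp` a central `M`-algebra. [cite: Kottwitz1992, Lemma 3.3 (proof, p. 384)] -/
theorem isCentral_MDop (hM : Set.range (algebraMap M D) = (Subalgebra.center L D : Set D)) :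
    Algebra.IsCentral M Dᵐᵒᵖ := by
  refine ⟨fun z hz ↦ ?_⟩
  have hz' : MulOpposite.unop z ∈ (Subalgebra.center L D : Set D) := by
    rw [SetLike.mem_coe, Subalgebra.mem_center_iff]
    intro b
    have h := Subalgebra.mem_center_iff.mp hz (MulOpposite.op b)
    have h' := congrArg MulOpposite.unop h
    rw [MulOpposite.unop_mul, MulOpposite.unop_mul, MulOpposite.unop_op] at h'
    exact h'.symm
  rw [← hM] at hz'
  obtain ⟨m, hm⟩ := hz'
  refine Algebra.mem_bot.mpr ⟨m, ?_⟩
  rw [MulOpposite.algebraMap_apply, hm, MulOpposite.op_unop]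

omit [Algebra L F] [IsScalarTower L F B] in
/-- `algebraMap F B f` is central in `B` (`Z(B) = F`). [cite: Kottwitz1992, Lemma 3.3 (proof, p. 384)] -/
theorem algebraMap_mem_center (hF : Set.range (algebraMap F B) = (Subalgebra.center L B : Set B)) (f : F) :
    algebraMap F B f ∈ Subalgebra.center L B := by
  rw [← SetLike.mem_coe, ← hF]
  exact ⟨f, rfl⟩

/-- A pure tensor of central elements is central in `B ⊗_L D^opp`. [cite: Kottwitz1992, Lemma 3.3 (proof, p. 384)] -/
theorem tmul_mem_center {b : B} (hb : b ∈ Subalgebra.center L B) (d : Dᵐᵒᵖ)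
    (hd : ∀ d' : Dᵐᵒᵖ, d' * d = d * d') : b ⊗ₜ[L] d ∈ Subalgebra.center L (B ⊗[L] Dᵐᵒᵖ) := by
  rw [Subalgebra.mem_center_iff]
  intro t
  induction t using TensorProduct.induction_on with
  | zero => rw [zero_mul, mul_zero]
  | tmul b' d' =>
    rw [Algebra.TensorProduct.tmul_mul_tmul, Algebra.TensorProduct.tmul_mul_tmul,
      Subalgebra.mem_center_iff.mp hb b', hd d']
  | add x y hx hy => rw [add_mul, mul_add, hx, hy]

/-- The image of `centerMap : F ⊗_L M → D' = B ⊗_L D^opp` is central («the center of `D'` is `F ⊗_L M`», p. 384; we only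
need this inclusion). [cite: Kottwitz1992, Lemma 3.3 (p. 384)] -/
theorem centerMap_mem_center (hF : Set.range (algebraMap F B) = (Subalgebra.center L B : Set B))
    (hM : Set.range (algebraMap M D) = (Subalgebra.center L D : Set D)) (z : F ⊗[L] M) :
    centerMap L F B M D z ∈ Subalgebra.center L (B ⊗[L] Dᵐᵒᵖ) := by
  induction z using TensorProduct.induction_on with
  | zero => rw [map_zero]; exact zero_mem _
  | tmul f m =>
    rw [centerMap, Algebra.TensorProduct.map_tmul]
    refine tmul_mem_center (algebraMap_mem_center hF f) _ fun d' ↦ ?_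
    -- `toMulOpposite m = op (algebraMap M D m)` is central in `D^opp`
    have hc : algebraMap M D m ∈ Subalgebra.center L D := by
      rw [← SetLike.mem_coe, ← hM]; exact ⟨m, rfl⟩
    have e1 : toMulOpposite L M D m = MulOpposite.op (algebraMap M D m) := rfl
    rw [e1]
    induction d' using MulOpposite.rec' with
    | h x =>
      rw [← MulOpposite.op_mul, ← MulOpposite.op_mul, Subalgebra.mem_center_iff.mp hc x]
  | add x y hx hy => rw [map_add]; exact add_mem hx hy

/-- `centerMap z` commutes with every element of `D'`. [cite: Kottwitz1992, Lemma 3.3 (proof, p. 384)] -/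
theorem centerMap_comm (hF : Set.range (algebraMap F B) = (Subalgebra.center L B : Set B))
    (hM : Set.range (algebraMap M D) = (Subalgebra.center L D : Set D)) (z : F ⊗[L] M) (t : B ⊗[L] Dᵐᵒᵖ) :
    centerMap L F B M D z * t = t * centerMap L F B M D z :=
  (Subalgebra.mem_center_iff.mp (centerMap_mem_center hF hM z) t).symm

/-- `centerMap (f ⊗ m) = f·1_B ⊗ op(m·1_D)`. [cite: Kottwitz1992, Lemma 3.3 (proof, p. 384)] -/
theorem centerMap_tmul (f : F) (m : M) :
    centerMap L F B M D (f ⊗ₜ[L] m) = algebraMap F B f ⊗ₜ[L] MulOpposite.op (algebraMap M D m) := rfl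

/-! ### §1 Lemma 3.3 (a): the annihilator of a simple `D'`-module in `F ⊗_L M` is a maximal ideal -/

section PartA

variable (L F B M D)

/-- The annihilator in `F ⊗_L M` of a `D'`-module `X` (the kernel of `F ⊗_L M → D' → End(X)`).
[cite: Kottwitz1992, Lemma 3.3 (proof, p. 384)] -/
theorem mem_ker_iff (X : Type*) [AddCommGroup X] [Module (B ⊗[L] Dᵐᵒᵖ) X] (z : F ⊗[L] M) :
    z ∈ RingHom.ker ((Module.toAddMonoidEnd (B ⊗[L] Dᵐᵒᵖ) X).comp (centerMap L F B M D).toRingHom) ↔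
      ∀ x : X, (centerMap L F B M D z) • x = 0 := by
  rw [RingHom.mem_ker, RingHom.comp_apply]
  constructor
  · intro h x
    exact DFunLike.congr_fun h x
  · intro h
    exact DFunLike.ext _ _ fun x ↦ h x

variable {L F B M D}

/-- Multiplication by a central element of `D'` as a `D'`-linear endomorphism of a `D'`-module. [cite: Kottwitz1992, Lemma 3.3 (proof, p. 384)] -/
theorem exists_linearMap_smul {c : B ⊗[L] Dᵐᵒᵖ} (hc : ∀ t : B ⊗[L] Dᵐᵒᵖ, c * t = t * c)
    (X : Type*) [AddCommGroup X] [Module (B ⊗[L] Dᵐᵒᵖ) X] :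
    ∃ g : X →ₗ[B ⊗[L] Dᵐᵒᵖ] X, ∀ x, g x = c • x :=
  ⟨{ toFun := fun x ↦ c • x
     map_add' := fun x y ↦ smul_add c x y
     map_smul' := fun t x ↦ by rw [RingHom.id_apply, smul_smul, smul_smul, hc t] }, fun _ ↦ rfl⟩

/-- **Lemma 3.3 (a), the prime**: for a simple `D'`-module `X`, the annihilator of `X` in `F ⊗_L M` is a prime ideal —
a central `z ∉ Ann` acts on `X` by a non-zero, hence (Schur) bijective, `D'`-linear map, so `zw ∈ Ann ⇒ w ∈ Ann`.
[cite: Kottwitz1992, Lemma 3.3 (p. 384)] -/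
theorem ker_isPrime (hF : Set.range (algebraMap F B) = (Subalgebra.center L B : Set B))
    (hM : Set.range (algebraMap M D) = (Subalgebra.center L D : Set D))
    (X : Type*) [AddCommGroup X] [Module (B ⊗[L] Dᵐᵒᵖ) X] [IsSimpleModule (B ⊗[L] Dᵐᵒᵖ) X] :
    (RingHom.ker ((Module.toAddMonoidEnd (B ⊗[L] Dᵐᵒᵖ) X).comp (centerMap L F B M D).toRingHom)).IsPrime := by
  haveI : Nontrivial X := IsSimpleModule.nontrivial (B ⊗[L] Dᵐᵒᵖ) X
  refine Ideal.isPrime_iff.mpr ⟨fun h1 ↦ ?_, fun {z w} hzw ↦ ?_⟩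
  · -- `1 ∉ Ann`
    rw [Ideal.eq_top_iff_one, mem_ker_iff] at h1
    obtain ⟨x, hx⟩ := exists_ne (0 : X)
    exact hx (by simpa using h1 x)
  · rw [mem_ker_iff] at hzw
    by_cases hz : z ∈ RingHom.ker ((Module.toAddMonoidEnd (B ⊗[L] Dᵐᵒᵖ) X).comp (centerMap L F B M D).toRingHom)
    · exact Or.inl hz
    right
    rw [mem_ker_iff] at hz ⊢
    push Not at hz
    obtain ⟨x₀, hx₀⟩ := hz
    obtain ⟨g, hg⟩ := exists_linearMap_smul (centerMap_comm hF hM z) X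
    have hg0 : g ≠ 0 := fun h ↦ hx₀ (by rw [← hg, h, LinearMap.zero_apply])
    have hbij := (g.bijective_or_eq_zero).resolve_right hg0
    intro x
    apply hbij.1
    rw [hg, map_zero, smul_smul, ← map_mul]
    exact hzw x

end PartA

/-! ### §2 The printed factor `(E ⊗_F B) ⊗_E (E ⊗_M D^opp)` is a simple artinian ring -/

section Factor

variable (E : Type u) [Field E] [Algebra F E] [Algebra M E]

omit [Algebra L F] [Algebra L B] [IsScalarTower L F B] [Algebra L M] [Algebra L D] [IsScalarTower L M D] in
/-- **The factor `D_j ≅ (B ⊗_F E) ⊗_E (D^opp ⊗_M E)` is simple** (p. 384): `E ⊗_F B` is central simple over `E` (base change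
of the central simple `F`-algebra `B`), `E ⊗_M D^opp` is simple, and the tensor product over `E` of a central simple and a simple
`E`-algebra is simple. [cite: Kottwitz1992, Lemma 3.3 (p. 384)] -/
theorem isSimpleRing_factor [Algebra.IsCentral F B] [IsSimpleRing B] [Algebra.IsCentral M Dᵐᵒᵖ] :
    IsSimpleRing ((E ⊗[F] B) ⊗[E] (E ⊗[M] Dᵐᵒᵖ)) := by
  haveI : IsSimpleRing (E ⊗[F] B) :=
    Literature.NumberTheory.Automorphic.IsSimpleRing.tensorProduct_of_isCentral' (K := F) (A := B) (B := E)
  haveI : Algebra.IsCentral E (E ⊗[F] B) :=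
    Literature.NumberTheory.Automorphic.BaseChange.isCentral_baseChange (K := F) (D := B) E
  haveI : IsSimpleRing (E ⊗[M] Dᵐᵒᵖ) :=
    Literature.NumberTheory.Automorphic.IsSimpleRing.tensorProduct_of_isCentral' (K := M) (A := Dᵐᵒᵖ) (B := E)
  exact Literature.NumberTheory.Automorphic.IsSimpleRing.tensorProduct_of_isCentral
    (K := E) (A := E ⊗[F] B) (B := E ⊗[M] Dᵐᵒᵖ)

omit [Algebra L F] [Algebra L B] [IsScalarTower L F B] [Algebra L M] [Algebra L D] [IsScalarTower L M D] in
/-- The factor is a non-zero ring. [cite: Kottwitz1992, Lemma 3.3 (proof, p. 384)] -/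
theorem one_ne_zero_factor [Algebra.IsCentral F B] [IsSimpleRing B] [Algebra.IsCentral M Dᵐᵒᵖ] :
    (1 : (E ⊗[F] B) ⊗[E] (E ⊗[M] Dᵐᵒᵖ)) ≠ 0 := by
  haveI := isSimpleRing_factor (F := F) (B := B) (M := M) (D := D) E
  -- (`NeZero (1 : _)` is not found by instance search through the nested tensor product; argue by hand)
  intro h
  obtain ⟨x, y, hxy⟩ := exists_pair_ne ((E ⊗[F] B) ⊗[E] (E ⊗[M] Dᵐᵒᵖ))
  have key : ∀ t : (E ⊗[F] B) ⊗[E] (E ⊗[M] Dᵐᵒᵖ), t = 0 := fun t ↦ by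
    have h1 : t * 1 = t * 0 := congrArg (t * ·) h
    have h2 : t * 0 = 0 := mul_zero t
    exact (mul_one t).symm.trans (h1.trans h2)
  exact hxy ((key x).trans (key y).symm)

/-- The factor is (left) artinian: it is finite-dimensional over `E`. [cite: Kottwitz1992, Lemma 3.3 (proof, p. 384)] -/
theorem isArtinianRing_factor [FiniteDimensional L B] [FiniteDimensional L D] :
    IsArtinianRing ((E ⊗[F] B) ⊗[E] (E ⊗[M] Dᵐᵒᵖ)) := by
  haveI : Module.Finite F B := finite_FB (L := L)
  haveI : Module.Finite M Dᵐᵒᵖ := finite_MDop (L := L)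
  haveI : Module.Finite E (E ⊗[F] B) := inferInstance
  haveI : Module.Finite E (E ⊗[M] Dᵐᵒᵖ) := inferInstance
  haveI : Module.Finite E ((E ⊗[F] B) ⊗[E] (E ⊗[M] Dᵐᵒᵖ)) := inferInstance
  exact IsArtinianRing.of_finite E ((E ⊗[F] B) ⊗[E] (E ⊗[M] Dᵐᵒᵖ))

omit [Algebra L F] [Algebra L B] [IsScalarTower L F B] [Algebra L M] [Algebra L D] [IsScalarTower L M D] in
/-- `E`-scalars on the left leg of the factor: `(x ⊗ 1) ⊗ 1 = x · 1`. [cite: Kottwitz1992, Lemma 3.3 (proof, p. 384)] -/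
theorem tmul_one_tmul_one (x : E) :
    (((x ⊗ₜ[F] (1 : B)) ⊗ₜ[E] (1 : E ⊗[M] Dᵐᵒᵖ)) : (E ⊗[F] B) ⊗[E] (E ⊗[M] Dᵐᵒᵖ)) =
      x • (1 : (E ⊗[F] B) ⊗[E] (E ⊗[M] Dᵐᵒᵖ)) := by
  have h1 : (x ⊗ₜ[F] (1 : B)) = x • ((1 : E) ⊗ₜ[F] (1 : B)) := by
    rw [TensorProduct.smul_tmul', smul_eq_mul, mul_one]
  rw [h1, ← TensorProduct.smul_tmul']
  rfl

omit [Algebra L F] [Algebra L B] [IsScalarTower L F B] [Algebra L M] [Algebra L D] [IsScalarTower L M D] in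
/-- `E`-scalars on the right leg of the factor: `1 ⊗ (x ⊗ 1) = x · 1`. [cite: Kottwitz1992, Lemma 3.3 (proof, p. 384)] -/
theorem one_tmul_tmul_one (x : E) :
    (((1 : E ⊗[F] B) ⊗ₜ[E] (x ⊗ₜ[M] (1 : Dᵐᵒᵖ))) : (E ⊗[F] B) ⊗[E] (E ⊗[M] Dᵐᵒᵖ)) =
      x • (1 : (E ⊗[F] B) ⊗[E] (E ⊗[M] Dᵐᵒᵖ)) := by
  have h2 : (x ⊗ₜ[M] (1 : Dᵐᵒᵖ)) = x • ((1 : E) ⊗ₜ[M] (1 : Dᵐᵒᵖ)) := by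
    rw [TensorProduct.smul_tmul', smul_eq_mul, mul_one]
  rw [h2, TensorProduct.tmul_smul]
  rfl

omit [Algebra L F] [Algebra L B] [IsScalarTower L F B] [Algebra L M] [Algebra L D] [IsScalarTower L M D] in
/-- `E`-scalars inside the factor: `(e ⊗ 1) ⊗ (e' ⊗ 1) = (e e') · 1`. [cite: Kottwitz1992, Lemma 3.3 (proof, p. 384)] -/
theorem tmul_one_tmul_tmul_one (e e' : E) :
    ((e ⊗ₜ[F] (1 : B)) ⊗ₜ[E] (e' ⊗ₜ[M] (1 : Dᵐᵒᵖ)) : (E ⊗[F] B) ⊗[E] (E ⊗[M] Dᵐᵒᵖ)) =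
      (e * e') • (1 : (E ⊗[F] B) ⊗[E] (E ⊗[M] Dᵐᵒᵖ)) := by
  have h1 : (e ⊗ₜ[F] (1 : B)) = e • ((1 : E) ⊗ₜ[F] (1 : B)) := by
    rw [TensorProduct.smul_tmul', smul_eq_mul, mul_one]
  have h2 : (e' ⊗ₜ[M] (1 : Dᵐᵒᵖ)) = e' • ((1 : E) ⊗ₜ[M] (1 : Dᵐᵒᵖ)) := by
    rw [TensorProduct.smul_tmul', smul_eq_mul, mul_one]
  rw [h1, h2, ← TensorProduct.smul_tmul', TensorProduct.tmul_smul, smul_smul]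
  rfl

omit [Algebra L F] [Algebra L B] [IsScalarTower L F B] [Algebra L M] [Algebra L D] [IsScalarTower L M D] in
/-- `1 ⊗ f·1_B = f·1`, i.e. `F`-scalars of `B` become `E`-scalars in `E ⊗_F B`. [cite: Kottwitz1992, Lemma 3.3 (proof, p. 384)] -/
theorem one_tmul_algebraMap_F (f : F) : ((1 : E) ⊗ₜ[F] algebraMap F B f) = (algebraMap F E f) ⊗ₜ[F] (1 : B) := by
  rw [Algebra.algebraMap_eq_smul_one, TensorProduct.tmul_smul, TensorProduct.smul_tmul', Algebra.algebraMap_eq_smul_one]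

omit [Algebra L F] [Algebra L B] [IsScalarTower L F B] [Algebra L M] [Algebra L D] [IsScalarTower L M D] in
/-- `1 ⊗ op(m·1_D) = m·1`, i.e. `M`-scalars of `D^opp` become `E`-scalars in `E ⊗_M D^opp`. [cite: Kottwitz1992, Lemma 3.3 (proof, p. 384)] -/
theorem one_tmul_algebraMap_M (m : M) :
    ((1 : E) ⊗ₜ[M] MulOpposite.op (algebraMap M D m)) = (algebraMap M E m) ⊗ₜ[M] (1 : Dᵐᵒᵖ) := by
  rw [← MulOpposite.algebraMap_apply, Algebra.algebraMap_eq_smul_one, TensorProduct.tmul_smul,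
    TensorProduct.smul_tmul', Algebra.algebraMap_eq_smul_one]

end Factor

/-! ### §3 The map `D' = B ⊗_L D^opp → (E ⊗_F B) ⊗_E (E ⊗_M D^opp)` -/

section Phi

variable (E : Type u) [Field E] [Algebra F E] [Algebra M E]

/-- **`Φ : D' → D_j`** (p. 384, the projection of `D'` onto its factor in the model `(B ⊗_F E) ⊗_E (D^opp ⊗_M E)`): the ring map
`b ⊗ d ↦ (1 ⊗ b) ⊗ (1 ⊗ d)`, for any field `E` receiving `F` and `M` compatibly over `L`. [cite: Kottwitz1992, Lemma 3.3 (p. 384)] -/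
theorem exists_ringHom_factor (hLE : ∀ c : L, algebraMap M E (algebraMap L M c) = algebraMap F E (algebraMap L F c)) :
    ∃ Φ : B ⊗[L] Dᵐᵒᵖ →+* (E ⊗[F] B) ⊗[E] (E ⊗[M] Dᵐᵒᵖ),
      ∀ (b : B) (d : Dᵐᵒᵖ), Φ (b ⊗ₜ[L] d) = ((1 : E) ⊗ₜ[F] b) ⊗ₜ[E] ((1 : E) ⊗ₜ[M] d) := by
  letI : Algebra L ((E ⊗[F] B) ⊗[E] (E ⊗[M] Dᵐᵒᵖ)) :=
    Algebra.compHom ((E ⊗[F] B) ⊗[E] (E ⊗[M] Dᵐᵒᵖ)) ((algebraMap F E).comp (algebraMap L F))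
  have halg : ∀ c : L, algebraMap L ((E ⊗[F] B) ⊗[E] (E ⊗[M] Dᵐᵒᵖ)) c =
      (algebraMap F E (algebraMap L F c)) • (1 : (E ⊗[F] B) ⊗[E] (E ⊗[M] Dᵐᵒᵖ)) := fun c ↦ by
    rw [Algebra.algebraMap_eq_smul_one]; rfl
  -- leg 1: `b ↦ (1 ⊗ b) ⊗ 1`
  let f : B →ₐ[L] (E ⊗[F] B) ⊗[E] (E ⊗[M] Dᵐᵒᵖ) :=
    { toRingHom := (Algebra.TensorProduct.includeLeftRingHom (R := E) (A := E ⊗[F] B) (B := E ⊗[M] Dᵐᵒᵖ)).comp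
        (Algebra.TensorProduct.includeRight (R := F) (A := E) (B := B)).toRingHom
      commutes' := fun c ↦ by
        rw [halg, IsScalarTower.algebraMap_apply L F B]
        change ((1 : E) ⊗ₜ[F] algebraMap F B (algebraMap L F c)) ⊗ₜ[E] (1 : E ⊗[M] Dᵐᵒᵖ) = _
        rw [one_tmul_algebraMap_F, tmul_one_tmul_one] }
  have hf : ∀ b : B, f b = ((1 : E) ⊗ₜ[F] b) ⊗ₜ[E] (1 : E ⊗[M] Dᵐᵒᵖ) := fun _ ↦ rfl
  -- leg 2: `d ↦ 1 ⊗ (1 ⊗ d)`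
  let g : Dᵐᵒᵖ →ₐ[L] (E ⊗[F] B) ⊗[E] (E ⊗[M] Dᵐᵒᵖ) :=
    { toRingHom := (Algebra.TensorProduct.includeRight (R := E) (A := E ⊗[F] B) (B := E ⊗[M] Dᵐᵒᵖ)).toRingHom.comp
        (Algebra.TensorProduct.includeRight (R := M) (A := E) (B := Dᵐᵒᵖ)).toRingHom
      commutes' := fun c ↦ by
        rw [halg, ← hLE, IsScalarTower.algebraMap_apply L M Dᵐᵒᵖ, MulOpposite.algebraMap_apply]
        change (1 : E ⊗[F] B) ⊗ₜ[E] ((1 : E) ⊗ₜ[M] MulOpposite.op (algebraMap M D (algebraMap L M c))) = _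
        rw [one_tmul_algebraMap_M, one_tmul_tmul_one] }
  have hg : ∀ d : Dᵐᵒᵖ, g d = (1 : E ⊗[F] B) ⊗ₜ[E] ((1 : E) ⊗ₜ[M] d) := fun _ ↦ rfl
  have hfg : ∀ b d, Commute (f b) (g d) := fun b d ↦ by
    rw [hf, hg, Commute, SemiconjBy, Algebra.TensorProduct.tmul_mul_tmul, Algebra.TensorProduct.tmul_mul_tmul, one_mul,
      mul_one, one_mul, mul_one]
  refine ⟨(Algebra.TensorProduct.lift f g hfg).toRingHom, fun b d ↦ ?_⟩
  change Algebra.TensorProduct.lift f g hfg (b ⊗ₜ[L] d) = _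
  rw [Algebra.TensorProduct.lift_tmul, hf, hg, Algebra.TensorProduct.tmul_mul_tmul, mul_one, one_mul]

omit [Algebra L F] [IsScalarTower L F B] [Algebra L M] [IsScalarTower L M D] in
/-- `Φ` on the centre: `Φ(f·1 ⊗ op(m·1)) = (f m) · 1`. [cite: Kottwitz1992, Lemma 3.3 (proof, p. 384)] -/
theorem factor_ringHom_centre (Φ : B ⊗[L] Dᵐᵒᵖ →+* (E ⊗[F] B) ⊗[E] (E ⊗[M] Dᵐᵒᵖ))
    (hΦ : ∀ (b : B) (d : Dᵐᵒᵖ), Φ (b ⊗ₜ[L] d) = ((1 : E) ⊗ₜ[F] b) ⊗ₜ[E] ((1 : E) ⊗ₜ[M] d)) (f : F) (m : M) :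
    Φ (algebraMap F B f ⊗ₜ[L] MulOpposite.op (algebraMap M D m)) =
      (algebraMap F E f * algebraMap M E m) • (1 : (E ⊗[F] B) ⊗[E] (E ⊗[M] Dᵐᵒᵖ)) := by
  rw [hΦ, one_tmul_algebraMap_F, one_tmul_algebraMap_M, tmul_one_tmul_tmul_one]

end Phi

/-! ### §4 A `D'`-module killed by `𝔪` is a module over the factor; simple modules over the factor are isomorphic -/

section Rho

variable (E : Type u) [Field E] [Algebra F E] [Algebra M E]
variable (X : Type u) [AddCommGroup X] [Module (B ⊗[L] Dᵐᵒᵖ) X] [Module E X]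

omit [Algebra L F] [IsScalarTower L F B] [Algebra L M] [IsScalarTower L M D] in
/-- **`X` is a `D_j`-module** (p. 384): a `D'`-module with a commuting `E`-vector space structure through which `F ⊆ B` and
`M ⊆ D^opp` act becomes a module over `(E ⊗_F B) ⊗_E (E ⊗_M D^opp)`, `((e ⊗ b) ⊗ (e' ⊗ d)) · x = (e e') · (b ⊗ d) · x` — built from
`B →ₐ[F] End_E(X)`, `D^opp →ₐ[M] End_E(X)` by the universal property of the tensor product of algebras.
[cite: Kottwitz1992, Lemma 3.3 (p. 384)] -/
theorem exists_ringHom_end (hc : ∀ (e : E) (t : B ⊗[L] Dᵐᵒᵖ) (x : X), e • t • x = t • e • x)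
    (hFX : ∀ (f : F) (x : X), algebraMap F E f • x = (algebraMap F B f ⊗ₜ[L] (1 : Dᵐᵒᵖ)) • x)
    (hMX : ∀ (m : M) (x : X), algebraMap M E m • x = ((1 : B) ⊗ₜ[L] MulOpposite.op (algebraMap M D m)) • x) :
    ∃ ρ : (E ⊗[F] B) ⊗[E] (E ⊗[M] Dᵐᵒᵖ) →+* Module.End E X,
      ∀ (e : E) (b : B) (e' : E) (d : Dᵐᵒᵖ) (x : X),
        ρ ((e ⊗ₜ[F] b) ⊗ₜ[E] (e' ⊗ₜ[M] d)) x = (e * e') • (b ⊗ₜ[L] d) • x := by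
  -- the action of `t ∈ D'` as an `E`-linear map
  let act : B ⊗[L] Dᵐᵒᵖ → Module.End E X := fun t ↦
    { toFun := fun x ↦ t • x
      map_add' := smul_add t
      map_smul' := fun e x ↦ (hc e t x).symm }
  have hact : ∀ t x, act t x = t • x := fun _ _ ↦ rfl
  have act_mul : ∀ t t', act (t * t') = act t * act t' := fun t t' ↦ by
    ext x; rw [Module.End.mul_apply, hact, hact, hact, mul_smul]
  -- `B →ₐ[F] End_E X`
  letI algF : Algebra F (Module.End E X) := Algebra.compHom (Module.End E X) (algebraMap F E)
  haveI : IsScalarTower F E (Module.End E X) := IsScalarTower.of_algebraMap_eq fun _ ↦ rfl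
  let β : B →ₐ[F] Module.End E X :=
    { toFun := fun b ↦ act (b ⊗ₜ[L] 1)
      map_one' := by ext x; rw [hact, ← Algebra.TensorProduct.one_def, one_smul, Module.End.one_apply]
      map_mul' := fun b b' ↦ by rw [← act_mul, Algebra.TensorProduct.tmul_mul_tmul, one_mul]
      map_zero' := by ext x; rw [hact, TensorProduct.zero_tmul, LinearMap.zero_apply]; exact zero_smul (B ⊗[L] Dᵐᵒᵖ) x
      map_add' := fun b b' ↦ by ext x; rw [hact, TensorProduct.add_tmul, add_smul, LinearMap.add_apply, hact, hact]
      commutes' := fun f ↦ by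
        ext x
        rw [hact, ← hFX]
        change _ = (algebraMap E (Module.End E X) (algebraMap F E f)) x
        rw [Module.algebraMap_end_apply] }
  have hβ : ∀ b x, β b x = (b ⊗ₜ[L] (1 : Dᵐᵒᵖ)) • x := fun _ _ ↦ rfl
  -- `D^opp →ₐ[M] End_E X`
  letI algM : Algebra M (Module.End E X) := Algebra.compHom (Module.End E X) (algebraMap M E)
  haveI : IsScalarTower M E (Module.End E X) := IsScalarTower.of_algebraMap_eq fun _ ↦ rfl
  let δ : Dᵐᵒᵖ →ₐ[M] Module.End E X :=
    { toFun := fun d ↦ act (1 ⊗ₜ[L] d)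
      map_one' := by ext x; rw [hact, ← Algebra.TensorProduct.one_def, one_smul, Module.End.one_apply]
      map_mul' := fun d d' ↦ by rw [← act_mul, Algebra.TensorProduct.tmul_mul_tmul, one_mul]
      map_zero' := by ext x; rw [hact, TensorProduct.tmul_zero, LinearMap.zero_apply]; exact zero_smul (B ⊗[L] Dᵐᵒᵖ) x
      map_add' := fun d d' ↦ by ext x; rw [hact, TensorProduct.tmul_add, add_smul, LinearMap.add_apply, hact, hact]
      commutes' := fun m ↦ by
        ext x
        rw [hact, MulOpposite.algebraMap_apply, ← hMX]
        change _ = (algebraMap E (Module.End E X) (algebraMap M E m)) x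
        rw [Module.algebraMap_end_apply] }
  have hδ : ∀ d x, δ d x = ((1 : B) ⊗ₜ[L] d) • x := fun _ _ ↦ rfl
  have hβδ : ∀ b d, Commute (β b) (δ d) := fun b d ↦ by
    change β b * δ d = δ d * β b
    ext x
    rw [Module.End.mul_apply, Module.End.mul_apply, hβ, hδ, hβ, hδ, smul_smul, smul_smul,
      Algebra.TensorProduct.tmul_mul_tmul, Algebra.TensorProduct.tmul_mul_tmul, one_mul, mul_one, one_mul, mul_one]
  -- the two halves
  let ρ₁ : E ⊗[F] B →ₐ[E] Module.End E X :=
    Algebra.TensorProduct.lift (Algebra.ofId E (Module.End E X)) β fun e b ↦ Algebra.commutes e (β b)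
  let ρ₂ : E ⊗[M] Dᵐᵒᵖ →ₐ[E] Module.End E X :=
    Algebra.TensorProduct.lift (Algebra.ofId E (Module.End E X)) δ fun e d ↦ Algebra.commutes e (δ d)
  have hρ₁ : ∀ e b, ρ₁ (e ⊗ₜ[F] b) = algebraMap E (Module.End E X) e * β b := fun e b ↦ by
    rw [Algebra.TensorProduct.lift_tmul]; rfl
  have hρ₂ : ∀ e d, ρ₂ (e ⊗ₜ[M] d) = algebraMap E (Module.End E X) e * δ d := fun e d ↦ by
    rw [Algebra.TensorProduct.lift_tmul]; rfl
  have hcomm : ∀ x y, Commute (ρ₁ x) (ρ₂ y) := by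
    intro x y
    induction x using TensorProduct.induction_on with
    | zero => rw [map_zero]; exact Commute.zero_left _
    | add x₁ x₂ h₁ h₂ => rw [map_add]; exact Commute.add_left h₁ h₂
    | tmul e b =>
      induction y using TensorProduct.induction_on with
      | zero => rw [map_zero]; exact Commute.zero_right _
      | add y₁ y₂ h₁ h₂ => rw [map_add]; exact Commute.add_right h₁ h₂
      | tmul e' d =>
        rw [hρ₁, hρ₂]
        exact Commute.mul_left
          (Commute.mul_right (Algebra.commutes e (algebraMap E _ e')) (Algebra.commutes e (δ d)))
          (Commute.mul_right (Algebra.commutes e' (β b)).symm (hβδ b d))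
  refine ⟨(Algebra.TensorProduct.lift ρ₁ ρ₂ hcomm).toRingHom, fun e b e' d x ↦ ?_⟩
  change Algebra.TensorProduct.lift ρ₁ ρ₂ hcomm ((e ⊗ₜ[F] b) ⊗ₜ[E] (e' ⊗ₜ[M] d)) x = _
  rw [Algebra.TensorProduct.lift_tmul, hρ₁, hρ₂, Module.End.mul_apply, Module.End.mul_apply, Module.End.mul_apply,
    Module.algebraMap_end_apply, Module.algebraMap_end_apply, hβ, hδ, ← hc e', smul_smul (b ⊗ₜ[L] (1 : Dᵐᵒᵖ)),
    Algebra.TensorProduct.tmul_mul_tmul, one_mul, mul_one, smul_smul e e']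

variable {E X} in
/-- Simplicity transfers from `D'` to the factor: every submodule for the factor is `D'`-stable. [cite: Kottwitz1992, Lemma 3.3 (proof, p. 384)] -/
theorem isSimpleModule_factor {S : Type*} [Ring S] [Module S X] [IsSimpleModule (B ⊗[L] Dᵐᵒᵖ) X]
    (h : ∀ (b : B) (d : Dᵐᵒᵖ), ∃ s : S, ∀ x : X, (b ⊗ₜ[L] d) • x = s • x) : IsSimpleModule S X := by
  haveI : Nontrivial X := IsSimpleModule.nontrivial (B ⊗[L] Dᵐᵒᵖ) X
  refine (isSimpleModule_iff S X).mpr ⟨fun N ↦ ?_⟩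
  -- the same carrier as a `D'`-submodule
  let N' : Submodule (B ⊗[L] Dᵐᵒᵖ) X :=
    { carrier := N
      zero_mem' := N.zero_mem
      add_mem' := fun ha hb ↦ N.add_mem ha hb
      smul_mem' := fun t x hx ↦ by
        induction t using TensorProduct.induction_on with
        | zero => exact (congrArg (· ∈ N) (zero_smul (B ⊗[L] Dᵐᵒᵖ) x)).mpr N.zero_mem
        | add t₁ t₂ h₁ h₂ => rw [add_smul]; exact N.add_mem h₁ h₂
        | tmul b d =>
          obtain ⟨s, hs⟩ := h b d
          change (b ⊗ₜ[L] d) • x ∈ N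
          rw [hs]; exact N.smul_mem s hx }
  have hmem : ∀ x, x ∈ N' ↔ x ∈ N := fun _ ↦ Iff.rfl
  rcases eq_bot_or_eq_top N' with h' | h'
  · left
    rw [eq_bot_iff]
    intro x hx
    have : x ∈ N' := (hmem x).mpr hx
    rw [h'] at this
    exact this
  · right
    rw [eq_top_iff]
    intro x _
    have : x ∈ N' := h' ▸ Submodule.mem_top
    exact (hmem x).mp this

omit [Algebra L F] [Algebra F B] [IsScalarTower L F B] [Algebra L M] [Algebra M D] [IsScalarTower L M D] in
/-- Two simple modules over a simple artinian ring are isomorphic (Mathlib's `IsSimpleRing.isIsotypic` applied to `X × X'`;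
«`D_j` is a simple algebra», p. 384, so it has one simple module). [cite: Kottwitz1992, Lemma 3.3 (proof, p. 384)] -/
theorem nonempty_linearEquiv_of_isSimpleRing {S : Type u} [Ring S] [IsSimpleRing S] [IsArtinianRing S]
    (Y Y' : Type u) [AddCommGroup Y] [Module S Y] [AddCommGroup Y'] [Module S Y'] [IsSimpleModule S Y]
    [IsSimpleModule S Y'] : Nonempty (Y ≃ₗ[S] Y') := by
  have hiso := IsSimpleRing.isIsotypic S (Y × Y')
  let m : Submodule S (Y × Y') := LinearMap.range (LinearMap.inl S Y Y')
  let m' : Submodule S (Y × Y') := LinearMap.range (LinearMap.inr S Y Y')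
  have em : Y ≃ₗ[S] m := LinearEquiv.ofInjective _ LinearMap.inl_injective
  have em' : Y' ≃ₗ[S] m' := LinearEquiv.ofInjective _ LinearMap.inr_injective
  haveI : IsSimpleModule S m := IsSimpleModule.congr em.symm
  haveI : IsSimpleModule S m' := IsSimpleModule.congr em'.symm
  obtain ⟨g⟩ := hiso m m'
  exact ⟨em.trans (g.symm.trans em'.symm)⟩

/-- **Lemma 3.3 (b), abstract form**: two SIMPLE `D'`-modules carrying compatible `E`-structures (for the same field `E ⊇ F, M`)
are isomorphic — both are simple modules over the simple artinian factor `(E ⊗_F B) ⊗_E (E ⊗_M D^opp)`, which has a single simple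
module. [cite: Kottwitz1992, Lemma 3.3 (p. 384)] -/
theorem nonempty_linearEquiv_of_factor [Algebra.IsCentral F B] [IsSimpleRing B] [Algebra.IsCentral M Dᵐᵒᵖ]
    [FiniteDimensional L B] [FiniteDimensional L D] [IsSimpleModule (B ⊗[L] Dᵐᵒᵖ) X]
    (hc : ∀ (e : E) (t : B ⊗[L] Dᵐᵒᵖ) (x : X), e • t • x = t • e • x)
    (hFX : ∀ (f : F) (x : X), algebraMap F E f • x = (algebraMap F B f ⊗ₜ[L] (1 : Dᵐᵒᵖ)) • x)
    (hMX : ∀ (m : M) (x : X), algebraMap M E m • x = ((1 : B) ⊗ₜ[L] MulOpposite.op (algebraMap M D m)) • x)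
    (X' : Type u) [AddCommGroup X'] [Module (B ⊗[L] Dᵐᵒᵖ) X'] [Module E X'] [IsSimpleModule (B ⊗[L] Dᵐᵒᵖ) X']
    (hc' : ∀ (e : E) (t : B ⊗[L] Dᵐᵒᵖ) (x : X'), e • t • x = t • e • x)
    (hFX' : ∀ (f : F) (x : X'), algebraMap F E f • x = (algebraMap F B f ⊗ₜ[L] (1 : Dᵐᵒᵖ)) • x)
    (hMX' : ∀ (m : M) (x : X'), algebraMap M E m • x = ((1 : B) ⊗ₜ[L] MulOpposite.op (algebraMap M D m)) • x) :
    Nonempty (X ≃ₗ[B ⊗[L] Dᵐᵒᵖ] X') := by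
  obtain ⟨ρ, hρ⟩ := exists_ringHom_end E X hc hFX hMX
  obtain ⟨ρ', hρ'⟩ := exists_ringHom_end E X' hc' hFX' hMX'
  letI : Module ((E ⊗[F] B) ⊗[E] (E ⊗[M] Dᵐᵒᵖ)) X := Module.compHom X ρ
  letI : Module ((E ⊗[F] B) ⊗[E] (E ⊗[M] Dᵐᵒᵖ)) X' := Module.compHom X' ρ'
  have key : ∀ (b : B) (d : Dᵐᵒᵖ) (x : X),
      ((((1 : E) ⊗ₜ[F] b) ⊗ₜ[E] ((1 : E) ⊗ₜ[M] d) : (E ⊗[F] B) ⊗[E] (E ⊗[M] Dᵐᵒᵖ)) • x) = (b ⊗ₜ[L] d) • x :=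
    fun b d x ↦ by
      change ρ _ x = _
      rw [hρ, one_mul, one_smul]
  have key' : ∀ (b : B) (d : Dᵐᵒᵖ) (x : X'),
      ((((1 : E) ⊗ₜ[F] b) ⊗ₜ[E] ((1 : E) ⊗ₜ[M] d) : (E ⊗[F] B) ⊗[E] (E ⊗[M] Dᵐᵒᵖ)) • x) = (b ⊗ₜ[L] d) • x :=
    fun b d x ↦ by
      change ρ' _ x = _
      rw [hρ', one_mul, one_smul]
  haveI : IsSimpleModule ((E ⊗[F] B) ⊗[E] (E ⊗[M] Dᵐᵒᵖ)) X :=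
    isSimpleModule_factor fun b d ↦ ⟨_, fun x ↦ (key b d x).symm⟩
  haveI : IsSimpleModule ((E ⊗[F] B) ⊗[E] (E ⊗[M] Dᵐᵒᵖ)) X' :=
    isSimpleModule_factor fun b d ↦ ⟨_, fun x ↦ (key' b d x).symm⟩
  haveI := isSimpleRing_factor (F := F) (B := B) (M := M) (D := D) E
  haveI := isArtinianRing_factor (L := L) (F := F) (B := B) (M := M) (D := D) E
  obtain ⟨g⟩ := nonempty_linearEquiv_of_isSimpleRing (S := (E ⊗[F] B) ⊗[E] (E ⊗[M] Dᵐᵒᵖ)) X X'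
  refine ⟨{ g.toAddEquiv with
    map_smul' := fun t x ↦ ?_ }⟩
  change g (t • x) = t • g x
  induction t using TensorProduct.induction_on with
  | zero =>
    exact (congrArg g (zero_smul (B ⊗[L] Dᵐᵒᵖ) x)).trans
      ((map_zero g).trans (zero_smul (B ⊗[L] Dᵐᵒᵖ) (g x)).symm)
  | add t₁ t₂ h₁ h₂ => rw [add_smul, add_smul, map_add, h₁, h₂]
  | tmul b d => rw [← key, map_smul, key']

end Rho

/-! ### §5 Assembly at `E = (F ⊗_L M)/𝔪` -/

section Assembly

/-- The compatibility over `L` of `F → (F ⊗_L M)/𝔪 ← M`. [cite: Kottwitz1992, Lemma 3.3 (proof, p. 384)] -/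
theorem algebraMap_quotient_comm (I : Ideal (F ⊗[L] M)) (c : L) :
    letI : Algebra M (F ⊗[L] M) := Algebra.TensorProduct.rightAlgebra
    algebraMap M ((F ⊗[L] M) ⧸ I) (algebraMap L M c) = algebraMap F ((F ⊗[L] M) ⧸ I) (algebraMap L F c) := by
  letI : Algebra M (F ⊗[L] M) := Algebra.TensorProduct.rightAlgebra
  rw [← IsScalarTower.algebraMap_apply L M ((F ⊗[L] M) ⧸ I), ← IsScalarTower.algebraMap_apply L F ((F ⊗[L] M) ⧸ I)]

set_option synthInstance.maxHeartbeats 200000 in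
/-- **Lemma 3.3 (c)**: every maximal ideal `𝔪` of `F ⊗_L M` annihilates some simple `D'`-module — `Φ` kills `𝔪`, so the left ideal
`D'𝔪 = 𝔪D'` is proper and any maximal left ideal above it gives a simple quotient killed by `𝔪`.
[cite: Kottwitz1992, Lemma 3.3 (p. 384)] -/
theorem exists_simple_annihilated (hF : Set.range (algebraMap F B) = (Subalgebra.center L B : Set B))
    (hM : Set.range (algebraMap M D) = (Subalgebra.center L D : Set D)) [FiniteDimensional L B] [IsSimpleRing B]
    [FiniteDimensional L D] (𝔪 : MaximalSpectrum (F ⊗[L] M)) :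
    ∃ (X : Type u) (_ : AddCommGroup X) (_ : Module (B ⊗[L] Dᵐᵒᵖ) X),
      IsSimpleModule (B ⊗[L] Dᵐᵒᵖ) X ∧ IsAnnihilatedBy L F B M D X 𝔪.asIdeal := by
  haveI := 𝔪.isMaximal
  letI : Field ((F ⊗[L] M) ⧸ 𝔪.asIdeal) := Ideal.Quotient.field 𝔪.asIdeal
  letI : Algebra M (F ⊗[L] M) := Algebra.TensorProduct.rightAlgebra
  haveI := isCentral_FB (L := L) hF
  haveI := isCentral_MDop (L := L) hM
  obtain ⟨Φ, hΦ⟩ := exists_ringHom_factor (L := L) (F := F) (B := B) (M := M) (D := D) ((F ⊗[L] M) ⧸ 𝔪.asIdeal)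
    (algebraMap_quotient_comm 𝔪.asIdeal)
  -- `Φ ∘ centerMap = algebraMap ∘ (mod 𝔪)`
  -- (the codomain of `Φ` is only ever named through `Φ`, to keep one instance path for the factor algebra)
  have hΦc : ∀ z : F ⊗[L] M, Φ (centerMap L F B M D z) = (Ideal.Quotient.mk 𝔪.asIdeal z) • Φ 1 := by
    intro z
    rw [Φ.map_one]
    induction z using TensorProduct.induction_on with
    | zero => rw [map_zero, map_zero, map_zero, zero_smul]
    | add x y hx hy => rw [map_add, map_add, hx, hy, map_add, add_smul]
    | tmul f m =>
      rw [centerMap_tmul, factor_ringHom_centre _ Φ hΦ]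
      congr 1
      rw [← Ideal.Quotient.mk_algebraMap, ← Ideal.Quotient.mk_algebraMap, ← map_mul]
      congr 1
      rw [Algebra.TensorProduct.right_algebraMap_apply, Algebra.TensorProduct.algebraMap_apply,
        Algebra.algebraMap_self_apply, Algebra.TensorProduct.tmul_mul_tmul, mul_one, one_mul]
  -- the left ideal generated by `centerMap 𝔪` is proper
  let I : Ideal (B ⊗[L] Dᵐᵒᵖ) := Ideal.span (centerMap L F B M D '' (𝔪.asIdeal : Set (F ⊗[L] M)))
  let K := RingHom.ker Φ
  have hK : ∀ t, t ∈ K ↔ Φ t = 0 := fun t ↦ RingHom.mem_ker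
  have hIker : I ≤ K := by
    refine Ideal.span_le.mpr ?_
    rintro _ ⟨z, hz, rfl⟩
    rw [SetLike.mem_coe, hK, hΦc, Ideal.Quotient.eq_zero_iff_mem.mpr hz, zero_smul]
  have hI : I ≠ ⊤ := by
    intro hI
    have h1 : (1 : B ⊗[L] Dᵐᵒᵖ) ∈ K := hIker (hI ▸ Submodule.mem_top)
    rw [hK, Φ.map_one] at h1
    exact one_ne_zero_factor (F := F) (B := B) (M := M) (D := D) ((F ⊗[L] M) ⧸ 𝔪.asIdeal) h1
  obtain ⟨N, hN, hIN⟩ := Ideal.exists_le_maximal I hI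
  refine ⟨(B ⊗[L] Dᵐᵒᵖ) ⧸ N, inferInstance, inferInstance, ?_, ?_⟩
  · exact (isSimpleModule_iff_isCoatom (m := N)).mpr (Ideal.isMaximal_def.mp hN)
  · intro z hz x
    induction x using Submodule.Quotient.induction_on with
    | H t =>
      rw [← Submodule.Quotient.mk_smul, Submodule.Quotient.mk_eq_zero, smul_eq_mul, centerMap_comm hF hM]
      exact hIN (I.mul_mem_left t (Ideal.subset_span ⟨z, hz, rfl⟩))

/-- **Lemma 3.3 (a)**: a simple `D'`-module is annihilated by exactly one maximal ideal of `F ⊗_L M` (its annihilator, which is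
prime by Schur's lemma and maximal because `F ⊗_L M` is artinian). [cite: Kottwitz1992, Lemma 3.3 (p. 384)] -/
theorem existsUnique_annihilator (hF : Set.range (algebraMap F B) = (Subalgebra.center L B : Set B))
    (hM : Set.range (algebraMap M D) = (Subalgebra.center L D : Set D)) [FiniteDimensional L B] [Nontrivial B]
    [FiniteDimensional L D] (X : Type u) [AddCommGroup X] [Module (B ⊗[L] Dᵐᵒᵖ) X] [IsSimpleModule (B ⊗[L] Dᵐᵒᵖ) X] :
    ∃! 𝔪 : MaximalSpectrum (F ⊗[L] M), IsAnnihilatedBy L F B M D X 𝔪.asIdeal := by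
  let P : Ideal (F ⊗[L] M) := RingHom.ker ((Module.toAddMonoidEnd (B ⊗[L] Dᵐᵒᵖ) X).comp (centerMap L F B M D).toRingHom)
  haveI hP : P.IsPrime := ker_isPrime hF hM X
  haveI : Module.Finite L F := finite_F (B := B)
  haveI : Module.Finite L M := finite_M (D := D)
  haveI : IsArtinianRing (F ⊗[L] M) := IsArtinianRing.of_finite L _
  haveI hPmax : P.IsMaximal := IsArtinianRing.isMaximal_of_isPrime P
  refine ⟨⟨P, hPmax⟩, fun z hz x ↦ (mem_ker_iff L F B M D X z).mp hz x, fun 𝔪' h𝔪' ↦ ?_⟩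
  have hle : 𝔪'.asIdeal ≤ P := fun z hz ↦ (mem_ker_iff L F B M D X z).mpr (h𝔪' z hz)
  have heq : 𝔪'.asIdeal = P := 𝔪'.isMaximal.eq_of_le hPmax.ne_top hle
  exact MaximalSpectrum.ext heq

set_option synthInstance.maxHeartbeats 200000 in
/-- **Lemma 3.3 (b)**: two simple `D'`-modules annihilated by the same maximal ideal `𝔪` of `F ⊗_L M` are isomorphic (both are
simple modules over the simple artinian factor at `E = (F ⊗_L M)/𝔪`). [cite: Kottwitz1992, Lemma 3.3 (p. 384)] -/
theorem nonempty_linearEquiv_of_annihilated (hF : Set.range (algebraMap F B) = (Subalgebra.center L B : Set B))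
    (hM : Set.range (algebraMap M D) = (Subalgebra.center L D : Set D)) [FiniteDimensional L B] [IsSimpleRing B]
    [FiniteDimensional L D] (𝔪 : MaximalSpectrum (F ⊗[L] M))
    (X : Type u) [AddCommGroup X] [Module (B ⊗[L] Dᵐᵒᵖ) X] [IsSimpleModule (B ⊗[L] Dᵐᵒᵖ) X]
    (X' : Type u) [AddCommGroup X'] [Module (B ⊗[L] Dᵐᵒᵖ) X'] [IsSimpleModule (B ⊗[L] Dᵐᵒᵖ) X']
    (hX : IsAnnihilatedBy L F B M D X 𝔪.asIdeal) (hX' : IsAnnihilatedBy L F B M D X' 𝔪.asIdeal) :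
    Nonempty (X ≃ₗ[B ⊗[L] Dᵐᵒᵖ] X') := by
  haveI := 𝔪.isMaximal
  letI : Field ((F ⊗[L] M) ⧸ 𝔪.asIdeal) := Ideal.Quotient.field 𝔪.asIdeal
  letI : Algebra M (F ⊗[L] M) := Algebra.TensorProduct.rightAlgebra
  haveI := isCentral_FB (L := L) hF
  haveI := isCentral_MDop (L := L) hM
  -- the `E`-structures, `E = (F ⊗ M)/𝔪`
  letI mZ : Module (F ⊗[L] M) X := Module.compHom X (centerMap L F B M D).toRingHom
  letI mZ' : Module (F ⊗[L] M) X' := Module.compHom X' (centerMap L F B M D).toRingHom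
  have hZ : ∀ (z : F ⊗[L] M) (x : X), z • x = centerMap L F B M D z • x := fun _ _ ↦ rfl
  have hZ' : ∀ (z : F ⊗[L] M) (x : X'), z • x = centerMap L F B M D z • x := fun _ _ ↦ rfl
  have htX : Module.IsTorsionBySet (F ⊗[L] M) X 𝔪.asIdeal := fun x ⟨z, hz⟩ ↦ by
    change z • x = 0; rw [hZ]; exact hX z hz x
  have htX' : Module.IsTorsionBySet (F ⊗[L] M) X' 𝔪.asIdeal := fun x ⟨z, hz⟩ ↦ by
    change z • x = 0; rw [hZ']; exact hX' z hz x
  letI mE : Module ((F ⊗[L] M) ⧸ 𝔪.asIdeal) X := htX.module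
  letI mE' : Module ((F ⊗[L] M) ⧸ 𝔪.asIdeal) X' := htX'.module
  have hE : ∀ (z : F ⊗[L] M) (x : X), (Ideal.Quotient.mk 𝔪.asIdeal z) • x = centerMap L F B M D z • x :=
    fun z x ↦ by rw [Module.IsTorsionBySet.mk_smul, hZ]
  have hE' : ∀ (z : F ⊗[L] M) (x : X'), (Ideal.Quotient.mk 𝔪.asIdeal z) • x = centerMap L F B M D z • x :=
    fun z x ↦ by rw [Module.IsTorsionBySet.mk_smul, hZ']
  refine nonempty_linearEquiv_of_factor (L := L) (F := F) (B := B) (M := M) (D := D) ((F ⊗[L] M) ⧸ 𝔪.asIdeal) X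
    ?_ ?_ ?_ X' ?_ ?_ ?_
  · intro e t x
    induction e using Quotient.inductionOn' with
    | h z =>
      change (Ideal.Quotient.mk 𝔪.asIdeal z) • t • x = t • (Ideal.Quotient.mk 𝔪.asIdeal z) • x
      rw [hE, hE, smul_smul, smul_smul, centerMap_comm hF hM]
  · intro f x
    rw [← Ideal.Quotient.mk_algebraMap, hE, Algebra.TensorProduct.algebraMap_apply, Algebra.algebraMap_self_apply, centerMap_tmul,
      map_one, MulOpposite.op_one]
  · intro m x
    rw [← Ideal.Quotient.mk_algebraMap, hE, Algebra.TensorProduct.right_algebraMap_apply, centerMap_tmul, map_one]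
  · intro e t x
    induction e using Quotient.inductionOn' with
    | h z =>
      change (Ideal.Quotient.mk 𝔪.asIdeal z) • t • x = t • (Ideal.Quotient.mk 𝔪.asIdeal z) • x
      rw [hE', hE', smul_smul, smul_smul, centerMap_comm hF hM]
  · intro f x
    rw [← Ideal.Quotient.mk_algebraMap, hE', Algebra.TensorProduct.algebraMap_apply, Algebra.algebraMap_self_apply, centerMap_tmul,
      map_one, MulOpposite.op_one]
  · intro m x
    rw [← Ideal.Quotient.mk_algebraMap, hE', Algebra.TensorProduct.right_algebraMap_apply, centerMap_tmul, map_one]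

end Assembly

end Lemma33

/-! ### The named fact -/

section Holds

variable (L : Type u) [Field L] (F : Type u) [Field F] [Algebra L F]
  (B : Type u) [Ring B] [Algebra L B] [Algebra F B] [IsScalarTower L F B]
  (M : Type u) [Field M] [Algebra L M] (D : Type u) [DivisionRing D] [Algebra L D] [Algebra M D]
  [IsScalarTower L M D]

/-- ★ `Kottwitz1992_3_3_simple_objects_bijection` HOLDS — **[Kottwitz1992, Lemma 3.3 (p. 384), first sentence]**: «This
construction sets up a bijection between the set of isomorphism classes of simple objects `(X, i)` in `𝒞_B` such that `X` is
isotypic of type `Y` and the set of factors `M_j` of `F ⊗_L M`» — in the carpet's reduced model (simple `B ⊗_L D^opp`-modules,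
maximal ideals of `F ⊗_L M`, the annihilator): (a) existence and uniqueness of the annihilating maximal ideal, (b) simple
modules with the same annihilator are isomorphic, (c) every maximal ideal occurs.  The printed «`char L = 0`» is carried but not
used (the proof only needs `Z(B) = F`, `Z(D) = M` and finite-dimensionality). [cite: Kottwitz1992, Lemma 3.3 (p. 384)] -/
theorem Kottwitz1992_3_3_simple_objects_bijection_holds : Kottwitz1992_3_3_simple_objects_bijection L F B M D := by
  intro _ _ _ hF _ hM
  haveI : Nontrivial B := inferInstance
  refine ⟨fun X _ _ _ ↦ Lemma33.existsUnique_annihilator hF hM X, fun X _ _ X' _ _ 𝔪 _ _ hX hX' ↦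
    Lemma33.nonempty_linearEquiv_of_annihilated hF hM 𝔪 X X' hX hX', fun 𝔪 ↦ Lemma33.exists_simple_annihilated hF hM 𝔪⟩

end Holds

end Literature.NumberTheory.Kottwitz1992.SemisimpleCategories
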